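import Summits.AtomisticToContinuum.BoseEinsteinCondensation.Theses.BECStronglyRayleigh
import Summits.AtomisticToContinuum.BoseEinsteinCondensation.Theorems.InsertionFieldDelocalisation.Negative.Tightness
import Literature.MathematicalPhysics.QuantumLattice.LiebMattisSectorPF
import HarnessLib

/-!
# `‖Ŝ⁻_tot ψ‖²` as a pair-insertion sum (helper for `LatticeCoherenceAssembly`,
# item stmt-AtomisticToContinuum-9680, route BECStronglyRayleigh)

Spin-`½` bookkeeping on a finite set `Λ` (occupied = spin up = `Fin`-index `0`, occupation
indicator `1_S = fun x => if x ∈ S then 0 else 1`):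

* `raise_mul_lower_eq` : `Ŝ⁺_tot Ŝ⁻_tot = (Ŝˣ_tot)² + (Ŝʸ_tot)² + Ŝᶻ_tot`, hence on the sector
  `Ŝᶻ_tot = M` one has `Re ⟨v, ((Ŝˣ)²+(Ŝʸ)²) v⟩ + M‖v‖² = ‖Ŝ⁻_tot v‖²` (`re_inner_planar_add`);
* `lower_mulVec_apply` : `(Ŝ⁻_tot ψ)(τ) = Σ_{y : τ_y = ↓} ψ(τ[y ↦ ↑])`;
* `re_norm_lower_eq_pairSum` : for a real vector `ψ` whose occupation amplitudes
  `φ(S) = Re ψ(1_S)` are supported on `N`-sets,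
  `‖Ŝ⁻_tot ψ‖² = Σ_{x,y} γ(x,y)` with `γ` the pair kernel of `PairKernelSumRule`;
* `re_norm_eq_sum_sq` : `‖ψ‖² = Σ_S φ(S)²`.
-/

noncomputable section

namespace Summit.AtomisticToContinuum.BoseEinsteinCondensation.Theorems.LatticeCoherence

open scoped BigOperators Matrix ComplexOrder
open Literature.MathematicalPhysics.QuantumLattice Matrix Finset Complex
open Summit.AtomisticToContinuum.BoseEinsteinCondensation.Theorems.InsertionFieldDelocalisation.Negative

variable {Λ : Type*} [Fintype Λ] [DecidableEq Λ]

/-! ### Ladder identities -/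

/-- `Ŝ⁺_tot Ŝ⁻_tot = (Ŝˣ_tot)² + (Ŝʸ_tot)² + Ŝᶻ_tot` (spin `½`; from `[Ŝˣ_tot, Ŝʸ_tot] = iŜᶻ_tot`).
[folklore] -/
theorem raise_mul_lower_eq :
    ((totalSpin 1 0 + I • totalSpin 1 1) * (totalSpin 1 0 - I • totalSpin 1 1) : Op Λ 2) =
      totalSpin 1 0 * totalSpin 1 0 + totalSpin 1 1 * totalSpin 1 1 + totalSpin 1 2 := by
  -- `(𝐒_tot)² = Ŝ⁺Ŝ⁻ + (Ŝᶻ)² - Ŝᶻ` and `(𝐒_tot)² = (Ŝˣ)² + (Ŝʸ)² + (Ŝᶻ)²`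
  have h := LiebMattis.totalSpinSq_eq_raise_mul_lower (Λ := Λ) 1
  rw [totalSpinSq, Fin.sum_univ_three] at h
  have h2 : ((totalSpin 1 0 + I • totalSpin 1 1) * (totalSpin 1 0 - I • totalSpin 1 1) : Op Λ 2) =
      totalSpin 1 0 * totalSpin 1 0 + totalSpin 1 1 * totalSpin 1 1 + totalSpin 1 2 * totalSpin 1 2 -
        totalSpin 1 2 * totalSpin 1 2 + totalSpin 1 2 := by
    rw [h]
    abel
  rw [h2]
  abel

/-- **`Re ⟨v, ((Ŝˣ_tot)² + (Ŝʸ_tot)²) v⟩ + M · Re ⟨v, v⟩ = ‖Ŝ⁻_tot v‖²` on the sector `Ŝᶻ_tot = M`.**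
[folklore] -/
theorem re_inner_planar_add (M : ℝ) (v : TensorIndex Λ 2 → ℂ) (hv : v ∈ spinZSector 1 M) :
    (star v ⬝ᵥ (totalSpin 1 0 * totalSpin 1 0 + totalSpin 1 1 * totalSpin 1 1 : Op Λ 2) *ᵥ v).re +
        M * (star v ⬝ᵥ v).re =
      (star ((totalSpin 1 0 - I • totalSpin 1 1 : Op Λ 2) *ᵥ v) ⬝ᵥ
        ((totalSpin 1 0 - I • totalSpin 1 1 : Op Λ 2) *ᵥ v)).re := by
  have h : (totalSpin 1 0 * totalSpin 1 0 + totalSpin 1 1 * totalSpin 1 1 : Op Λ 2) =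
      (totalSpin 1 0 + I • totalSpin 1 1) * (totalSpin 1 0 - I • totalSpin 1 1) - totalSpin 1 2 := by
    rw [raise_mul_lower_eq, add_sub_cancel_right]
  rw [h, sub_mulVec, ← mulVec_mulVec, LiebMattis.totalSpin_two_mulVec_of_mem 1 hv, dotProduct_sub,
    dotProduct_smul, smul_eq_mul, Complex.sub_re, Complex.re_ofReal_mul, dotProduct_mulVec, star_mulVec,
    LiebMattis.conjTranspose_totalSpin_lower]
  ring

/-! ### `Ŝ⁻_tot` on coefficients -/

/-- The spin-`½` lowering matrix: `⟨k| S⁻ |l⟩ = [k = ↓, l = ↑]`. [folklore] -/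
theorem spinLower_one_apply (k l : Fin 2) :
    spinLower 1 k l = if k = 1 ∧ l = 0 then 1 else 0 := by
  rw [spinLower_apply]
  fin_cases k <;> fin_cases l <;> simp

/-- **`(Ŝ⁻_tot ψ)(τ) = Σ_{y : τ_y = ↓} ψ(τ[y ↦ ↑])`** (spin `½`). [folklore] -/
theorem lower_mulVec_apply (ψ : TensorIndex Λ 2 → ℂ) (τ : TensorIndex Λ 2) :
    ((totalSpin 1 0 - I • totalSpin 1 1 : Op Λ 2) *ᵥ ψ) τ =
      ∑ y, if τ y = 1 then ψ (Function.update τ y 0) else 0 := by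
  rw [LiebMattis.totalSpin_lower_eq_sum_onSite, Matrix.sum_mulVec, Finset.sum_apply]
  refine Finset.sum_congr rfl fun y _ => ?_
  rw [LiebMattis.onSite_mulVec_apply, Fin.sum_univ_two, spinLower_one_apply, spinLower_one_apply]
  by_cases h : τ y = 1
  · simp [h]
  · have h0 : τ y = 0 := by
      rcases Fin.exists_fin_two.mp ⟨τ y, rfl⟩ with h' | h'
      · exact h'
      · exact absurd h' h
    simp [h0]

/-! ### Occupation indicators -/

omit [Fintype Λ] in
/-- Raising the spin at `y` in `1_T` gives `1_{T ∪ {y}}`. [folklore] -/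
theorem update_ind_zero (T : Finset Λ) (y : Λ) :
    Function.update (fun x => if x ∈ T then (0 : Fin 2) else 1) y 0 =
      fun x => if x ∈ insert y T then (0 : Fin 2) else 1 := by
  funext x
  by_cases hx : x = y
  · subst hx
    simp
  · rw [Function.update_of_ne hx]
    simp [Finset.mem_insert, hx]

/-- **Configurations ↔ occupied sets**: reindex a sum over `{↑,↓}^Λ` by `S ↦ 1_S`. [folklore] -/
theorem sum_config_eq_sum_finset {β : Type*} [AddCommMonoid β] (F : TensorIndex Λ 2 → β) :
    ∑ σ, F σ = ∑ S : Finset Λ, F (fun x => if x ∈ S then 0 else 1) := by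
  refine Fintype.sum_equiv
    ⟨fun σ => Finset.univ.filter fun x => σ x = 0, fun S => fun x => if x ∈ S then 0 else 1,
      fun σ => ind_filter_eq σ, fun S => ?_⟩ _ _ fun σ => ?_
  · ext x
    by_cases hx : x ∈ S <;> simp [hx]
  · simp only [Equiv.coe_fn_mk]
    rw [ind_filter_eq σ]

/-- A sector-`(N - |Λ|/2)` vector has occupation amplitudes supported on `N`-sets. [folklore] -/
theorem apply_ind_eq_zero_of_card_ne {M : ℝ} (N : ℕ) (hM : M = (N : ℝ) - (Fintype.card Λ : ℝ) / 2)
    {ψ : TensorIndex Λ 2 → ℂ} (hψ : ψ ∈ spinZSector 1 M) (S : Finset Λ) (hS : S.card ≠ N) :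
    ψ (fun x => if x ∈ S then 0 else 1) = 0 := by
  by_contra h
  have hmag := (LiebMattis.mem_spinZSector_iff 1 M ψ).mp hψ _ h
  rw [magnetisation_ind, hM] at hmag
  push_cast at hmag
  have hc : (S.card : ℂ) = (N : ℂ) := by linear_combination hmag
  exact hS (by exact_mod_cast hc)

/-! ### Pair-insertion sums -/

/-- Diagonal pair kernel: `Σ_{T ∌ x} φ(T ∪ {x})² = Σ_{S ∋ x} φ(S)²` (`T ↦ T ∪ {x}`). [folklore] -/
theorem sum_insert_mul_self_eq (φ : Finset Λ → ℝ) (x : Λ) :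
    ∑ T : Finset Λ, (if x ∉ T ∧ x ∉ T then φ (insert x T) * φ (insert x T) else 0) =
      ∑ S : Finset Λ, (if x ∈ S then φ S ^ 2 else 0) := by
  rw [← Finset.sum_filter, ← Finset.sum_filter]
  refine Finset.sum_nbij' (insert x) (fun S => S.erase x) ?_ ?_ ?_ ?_ ?_
  · intro T _
    simp
  · intro S _
    simp
  · intro T hT
    simp only [and_self, Finset.mem_filter, Finset.mem_univ, true_and] at hT
    exact Finset.erase_insert hT
  · intro S hS
    simp only [Finset.mem_filter, Finset.mem_univ, true_and] at hS
    exact Finset.insert_erase hS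
  · intro T _
    exact (sq _).symm

/-- Off-diagonal pair kernel: if `φ` is supported on `N`-sets, only `|T| = N - 1` contributes to
`Σ_{T ∌ x,y} φ(T ∪ {x}) φ(T ∪ {y})`. [folklore] -/
theorem sum_insert_mul_insert_eq (N : ℕ) (φ : Finset Λ → ℝ)
    (hsupp : ∀ S, S.card ≠ N → φ S = 0) (x y : Λ) :
    ∑ T : Finset Λ, (if x ∉ T ∧ y ∉ T then φ (insert x T) * φ (insert y T) else 0) =
      ∑ T ∈ (Finset.univ : Finset Λ).powersetCard (N - 1),
        (if x ∉ T ∧ y ∉ T then φ (insert x T) * φ (insert y T) else 0) := by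
  symm
  refine Finset.sum_subset (Finset.subset_univ _) fun T _ hT => ?_
  split_ifs with h
  · have hcard : T.card ≠ N - 1 := by
      simpa [Finset.mem_powersetCard] using hT
    rw [hsupp (insert x T) ?_, zero_mul]
    rw [Finset.card_insert_of_notMem h.1]
    omega
  · rfl

/-- **`‖Ŝ⁻_tot ψ‖² = Σ_{x,y} γ(x,y)`**: for a real vector `ψ` with occupation amplitudes
`φ(S) = Re ψ(1_S)` supported on `N`-sets, `‖Ŝ⁻_tot ψ‖²` is the total pair kernel of
`PairKernelSumRule` — `γ(x,x) = Σ_{S ∋ x} φ(S)²`, `γ(x,y) = Σ_{|T|=N-1, x,y ∉ T} φ(T∪{x})φ(T∪{y})`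
(spin-`½` matrix elements of `S⁺_x S⁻_y` are `1`). [folklore] -/
theorem re_norm_lower_eq_pairSum (N : ℕ) (ψ : TensorIndex Λ 2 → ℂ) (hreal : ∀ σ, (ψ σ).im = 0)
    (φ : Finset Λ → ℝ) (hφ : ∀ S, φ S = (ψ (fun x => if x ∈ S then 0 else 1)).re)
    (hsupp : ∀ S, S.card ≠ N → φ S = 0) :
    (star ((totalSpin 1 0 - I • totalSpin 1 1 : Op Λ 2) *ᵥ ψ) ⬝ᵥ
        ((totalSpin 1 0 - I • totalSpin 1 1 : Op Λ 2) *ᵥ ψ)).re =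
      ∑ x : Λ, ∑ y : Λ, (if x = y then ∑ S : Finset Λ, (if x ∈ S then φ S ^ 2 else 0)
        else ∑ T ∈ (Finset.univ : Finset Λ).powersetCard (N - 1),
          (if x ∉ T ∧ y ∉ T then φ (insert x T) * φ (insert y T) else 0)) := by
  set Sm : Op Λ 2 := totalSpin 1 0 - I • totalSpin 1 1 with hSm
  have hψre : ∀ σ, ψ σ = ((ψ σ).re : ℂ) := fun σ =>
    Complex.ext (by simp) (by simp [hreal σ])
  -- the coefficients of `Ŝ⁻ψ` are the real numbers `g τ`
  have hcoef : ∀ τ, (Sm *ᵥ ψ) τ =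
      ((∑ y, if τ y = 1 then (ψ (Function.update τ y 0)).re else 0 : ℝ) : ℂ) := by
    intro τ
    rw [hSm, lower_mulVec_apply]
    push_cast
    refine Finset.sum_congr rfl fun y _ => ?_
    split_ifs
    · exact hψre _
    · rfl
  have h1 : (star (Sm *ᵥ ψ) ⬝ᵥ (Sm *ᵥ ψ)).re =
      ∑ τ, (∑ y, if τ y = 1 then (ψ (Function.update τ y 0)).re else 0) ^ 2 := by
    rw [dotProduct, Complex.re_sum]
    refine Finset.sum_congr rfl fun τ _ => ?_
    rw [Pi.star_apply, hcoef τ, Complex.star_def, Complex.conj_ofReal, ← Complex.ofReal_mul,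
      Complex.ofReal_re, sq]
  rw [h1, sum_config_eq_sum_finset]
  -- `g(1_T) = Σ_{y ∉ T} φ(T ∪ {y})`
  have h2 : ∀ T : Finset Λ,
      (∑ y, if (fun x => if x ∈ T then (0 : Fin 2) else 1) y = 1 then
          (ψ (Function.update (fun x => if x ∈ T then (0 : Fin 2) else 1) y 0)).re else 0) =
        ∑ y, if y ∉ T then φ (insert y T) else 0 := by
    intro T
    refine Finset.sum_congr rfl fun y _ => ?_
    by_cases hy : y ∈ T
    · simp [hy]
    · rw [if_pos (by simp [hy]), if_pos hy, hφ, update_ind_zero]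
  simp_rw [h2]
  -- expand the squares and exchange the sums
  have h3 : ∀ T : Finset Λ, (∑ y, if y ∉ T then φ (insert y T) else 0) ^ 2 =
      ∑ x, ∑ y, if x ∉ T ∧ y ∉ T then φ (insert x T) * φ (insert y T) else 0 := by
    intro T
    rw [sq, Finset.sum_mul_sum]
    refine Finset.sum_congr rfl fun x _ => Finset.sum_congr rfl fun y _ => ?_
    by_cases hx : x ∈ T <;> by_cases hy : y ∈ T <;> simp [hx, hy]
  simp_rw [h3]
  rw [Finset.sum_comm]
  refine Finset.sum_congr rfl fun x _ => ?_
  rw [Finset.sum_comm]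
  refine Finset.sum_congr rfl fun y _ => ?_
  split_ifs with hxy
  · subst hxy
    exact sum_insert_mul_self_eq φ x
  · exact sum_insert_mul_insert_eq N φ hsupp x y

/-- **`‖ψ‖² = Σ_S φ(S)²`** for a real vector with occupation amplitudes `φ(S) = Re ψ(1_S)`.
[folklore] -/
theorem re_norm_eq_sum_sq (ψ : TensorIndex Λ 2 → ℂ) (hreal : ∀ σ, (ψ σ).im = 0)
    (φ : Finset Λ → ℝ) (hφ : ∀ S, φ S = (ψ (fun x => if x ∈ S then 0 else 1)).re) :
    (star ψ ⬝ᵥ ψ).re = ∑ S : Finset Λ, φ S ^ 2 := by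
  have hψre : ∀ σ, ψ σ = ((ψ σ).re : ℂ) := fun σ =>
    Complex.ext (by simp) (by simp [hreal σ])
  rw [dotProduct, Complex.re_sum, sum_config_eq_sum_finset]
  refine Finset.sum_congr rfl fun S _ => ?_
  rw [Pi.star_apply, hψre, Complex.star_def, Complex.conj_ofReal, ← Complex.ofReal_mul,
    Complex.ofReal_re, hφ, sq]

/-- The occupation polynomial of a real vector has the real coefficients `φ(S) = Re ψ(1_S)`.
[folklore] -/
theorem occPoly_eq (ψ : TensorIndex Λ 2 → ℂ) (hreal : ∀ σ, (ψ σ).im = 0)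
    (φ : Finset Λ → ℝ) (hφ : ∀ S, φ S = (ψ (fun x => if x ∈ S then 0 else 1)).re) (z : Λ → ℂ) :
    (∑ S : Finset Λ, ψ (fun x => if x ∈ S then 0 else 1) * ∏ x ∈ S, z x) =
      ∑ S : Finset Λ, (φ S : ℂ) * ∏ x ∈ S, z x := by
  refine Finset.sum_congr rfl fun S _ => ?_
  rw [hφ]
  congr 1
  exact Complex.ext (by simp) (by simp [hreal _])

end Summit.AtomisticToContinuum.BoseEinsteinCondensation.Theorems.LatticeCoherence
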